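import Mathlib

/-!
# Exponentially convex kernels: an elementary null-vector rigidity (support lemma for `DetectorRigidity`, stub 1)

Route `UniversalDetector`, lever crux `DetectorRigidity` (stmt-QuantumFields-26595), ideator seat ym-idea-8 g4.

The remaining stub of the crux's birth skeleton (`Stmt_semigroupKill`, labelled XL "injective OS semigroup") has an
ELEMENTARY heart, isolated and proved here with no Hilbert space, no spectral theorem and no Bernstein–Widder theorem.
Let `φ` be continuous on `(0,∞)` and let the Hankel form `Q(f,g) = ∫∫ f(s) g(t) φ(s+t) ds dt` be positive
semi-definite on `ℝ·h + C_c^∞((0,∞))`, where `h ≥ 0` is a non-zero continuous function compactly supported in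
`(0,∞)` with `Q(h,h) = 0`.  Then `φ ≡ 0` on `(0,∞)`:
* positivity of `Q` on narrow bumps and continuity give `φ ≥ 0` pointwise;
* the quadratic `λ ↦ Q(h+λg, h+λg) ≥ 0` with `Q(h,h)=0` kills the cross term `Q(h,g)` (Cauchy–Schwarz without a norm);
* for `g ≥ 0` the integrand `h(s)g(t)φ(s+t) ≥ 0` is continuous with zero integral, hence vanishes: `φ = 0` on
  `(s₀,∞)` for any `s₀` with `h(s₀) > 0`;
* a bump `m` centred just above `σ/2` is then itself `Q`-null once `φ = 0` on `(σ,∞)`, so the same engine halves the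
  threshold; induction and the Archimedean property finish.
In the OS application (`Stmt_semigroupKill`), `φ(u) = (π/2)^{3/2} ∫_{ℝ³} K(u,z) e^{-|z|²/2} dz` is the Gaussian spatial
slice of the detector kernel, `Q` is the reflection-positive mirror pairing restricted to Gaussian-profile vectors
`a(y₀) e^{-|y|²}`, and the conclusion `φ ≡ 0` makes every such vector null, whence the stub by Cauchy–Schwarz; that
4D → 1D reduction is measure plumbing left to the skeleton.  No summit, leg or spine crux is proved here.
-/

set_option autoImplicit false

noncomputable section

open MeasureTheory Filter Set Metric
open scoped ContDiff Topology

namespace Summit.QuantumFields.YangMills.Cruxes.DetectorRigidity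

/-! ### The Hankel integrand `(s,t) ↦ f(s) g(t) φ(s+t)` -/

/-- The Hankel integrand of two test functions supported in `(0,∞)` is continuous on `ℝ²` although `φ` is only
continuous on `(0,∞)`. -/
private theorem hankel_continuous {φ f g : ℝ → ℝ} (hφ : ContinuousOn φ (Ioi 0)) (hf : Continuous f)
    (hg : Continuous g) (hf0 : tsupport f ⊆ Ioi 0) (hg0 : tsupport g ⊆ Ioi 0) :
    Continuous fun p : ℝ × ℝ => f p.1 * g p.2 * φ (p.1 + p.2) := by
  rw [continuous_iff_continuousAt]
  rintro ⟨s, t⟩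
  by_cases hs : s ∈ tsupport f
  · by_cases ht : t ∈ tsupport g
    · have hpos : 0 < s + t := add_pos (hf0 hs) (hg0 ht)
      have hφc : ContinuousAt φ (s + t) := hφ.continuousAt (Ioi_mem_nhds hpos)
      exact ((hf.continuousAt.comp continuousAt_fst).mul (hg.continuousAt.comp continuousAt_snd)).mul
        (ContinuousAt.comp_of_eq hφc (continuousAt_fst.add continuousAt_snd) rfl)
    · have hg' : g =ᶠ[𝓝 t] 0 := notMem_tsupport_iff_eventuallyEq.mp ht
      have hev : (fun _ : ℝ × ℝ => (0 : ℝ)) =ᶠ[𝓝 (s, t)] fun p => f p.1 * g p.2 * φ (p.1 + p.2) := by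
        have h2 := (continuousAt_snd (p := (s, t))).eventually hg'
        filter_upwards [h2] with p hp
        simp [hp]
      exact continuousAt_const.congr hev
  · have hf' : f =ᶠ[𝓝 s] 0 := notMem_tsupport_iff_eventuallyEq.mp hs
    have hev : (fun _ : ℝ × ℝ => (0 : ℝ)) =ᶠ[𝓝 (s, t)] fun p => f p.1 * g p.2 * φ (p.1 + p.2) := by
      have h2 := (continuousAt_fst (p := (s, t))).eventually hf'
      filter_upwards [h2] with p hp
      simp [hp]
    exact continuousAt_const.congr hev

/-- The Hankel integrand of two compactly supported functions has compact support. -/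
private theorem hankel_hasCompactSupport {φ f g : ℝ → ℝ} (hfc : HasCompactSupport f)
    (hgc : HasCompactSupport g) :
    HasCompactSupport fun p : ℝ × ℝ => f p.1 * g p.2 * φ (p.1 + p.2) := by
  refine HasCompactSupport.intro (hfc.prod hgc) ?_
  rintro ⟨s, t⟩ hp
  rw [Set.mem_prod, not_and_or] at hp
  rcases hp with hs | ht
  · simp [image_eq_zero_of_notMem_tsupport hs]
  · simp [image_eq_zero_of_notMem_tsupport ht]

/-- Integrability of the Hankel integrand. -/
private theorem hankel_integrable {φ f g : ℝ → ℝ} (hφ : ContinuousOn φ (Ioi 0)) (hf : Continuous f)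
    (hg : Continuous g) (hfc : HasCompactSupport f) (hgc : HasCompactSupport g)
    (hf0 : tsupport f ⊆ Ioi 0) (hg0 : tsupport g ⊆ Ioi 0) :
    Integrable (fun p : ℝ × ℝ => f p.1 * g p.2 * φ (p.1 + p.2)) :=
  (hankel_continuous hφ hf hg hf0 hg0).integrable_of_hasCompactSupport (hankel_hasCompactSupport hfc hgc)

/-- Symmetry of the Hankel form. -/
private theorem hankel_symm {φ f g : ℝ → ℝ} :
    ∫ p : ℝ × ℝ, g p.1 * f p.2 * φ (p.1 + p.2) = ∫ p : ℝ × ℝ, f p.1 * g p.2 * φ (p.1 + p.2) := by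
  have h := integral_prod_swap (μ := (volume : Measure ℝ)) (ν := (volume : Measure ℝ))
    (fun p : ℝ × ℝ => f p.1 * g p.2 * φ (p.1 + p.2))
  rw [← Measure.volume_eq_prod] at h
  simp only [Prod.fst_swap, Prod.snd_swap] at h
  rw [← h]
  refine integral_congr_ae (Eventually.of_forall fun p => ?_)
  simp only
  rw [add_comm]
  ring

/-- Expansion of the Hankel quadratic form along a line. -/
private theorem hankel_expand {φ f g : ℝ → ℝ} (hφ : ContinuousOn φ (Ioi 0)) (hf : Continuous f)
    (hg : Continuous g) (hfc : HasCompactSupport f) (hgc : HasCompactSupport g)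
    (hf0 : tsupport f ⊆ Ioi 0) (hg0 : tsupport g ⊆ Ioi 0) (c : ℝ) :
    ∫ p : ℝ × ℝ, (f p.1 + c * g p.1) * (f p.2 + c * g p.2) * φ (p.1 + p.2) =
      (∫ p : ℝ × ℝ, f p.1 * f p.2 * φ (p.1 + p.2)) +
        2 * c * (∫ p : ℝ × ℝ, f p.1 * g p.2 * φ (p.1 + p.2)) +
        c ^ 2 * ∫ p : ℝ × ℝ, g p.1 * g p.2 * φ (p.1 + p.2) := by
  have iff' := hankel_integrable hφ hf hf hfc hfc hf0 hf0
  have ifg := hankel_integrable hφ hf hg hfc hgc hf0 hg0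
  have igf := hankel_integrable hφ hg hf hgc hfc hg0 hf0
  have igg := hankel_integrable hφ hg hg hgc hgc hg0 hg0
  have e : ∀ p : ℝ × ℝ, (f p.1 + c * g p.1) * (f p.2 + c * g p.2) * φ (p.1 + p.2) =
      (f p.1 * f p.2 * φ (p.1 + p.2) + c * (f p.1 * g p.2 * φ (p.1 + p.2))) +
        (c * (g p.1 * f p.2 * φ (p.1 + p.2)) + c ^ 2 * (g p.1 * g p.2 * φ (p.1 + p.2))) := by
    intro p; ring
  simp_rw [e]
  have i1 : Integrable (fun p : ℝ × ℝ =>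
      f p.1 * f p.2 * φ (p.1 + p.2) + c * (f p.1 * g p.2 * φ (p.1 + p.2))) := iff'.add (ifg.const_mul c)
  have i2 : Integrable (fun p : ℝ × ℝ =>
      c * (g p.1 * f p.2 * φ (p.1 + p.2)) + c ^ 2 * (g p.1 * g p.2 * φ (p.1 + p.2))) :=
    (igf.const_mul c).add (igg.const_mul (c ^ 2))
  have i3 : Integrable (fun p : ℝ × ℝ => c * (f p.1 * g p.2 * φ (p.1 + p.2))) := ifg.const_mul c
  have i4 : Integrable (fun p : ℝ × ℝ => c * (g p.1 * f p.2 * φ (p.1 + p.2))) := igf.const_mul c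
  have i5 : Integrable (fun p : ℝ × ℝ => c ^ 2 * (g p.1 * g p.2 * φ (p.1 + p.2))) := igg.const_mul (c ^ 2)
  rw [integral_add i1 i2, integral_add iff' i3, integral_add i4 i5,
    integral_const_mul, integral_const_mul, integral_const_mul, hankel_symm (φ := φ) (f := f) (g := g)]
  ring

/-- Cauchy–Schwarz without a norm: a non-negative quadratic with vanishing constant term has no linear term. -/
private theorem eq_zero_of_quadratic_nonneg {B C : ℝ} (h : ∀ c : ℝ, 0 ≤ 2 * c * B + c ^ 2 * C) : B = 0 := by
  by_contra hB
  have hB2 : 0 < B ^ 2 := lt_of_le_of_ne (sq_nonneg B) (Ne.symm (pow_ne_zero 2 hB))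
  rcases le_or_gt C 0 with hC | hC
  · have h1 := h (-B)
    nlinarith
  · have h1 := h (-B / C)
    have h2 : 2 * (-B / C) * B + (-B / C) ^ 2 * C = -(B ^ 2 / C) := by
      field_simp; ring
    rw [h2] at h1
    have h3 : 0 < B ^ 2 / C := div_pos hB2 hC
    linarith

/-- The support of `f + c g` sits inside the union of the supports. -/
private theorem tsupport_add_mul_subset {f g : ℝ → ℝ} (c : ℝ) :
    tsupport (fun x => f x + c * g x) ⊆ tsupport f ∪ tsupport g := by
  have hs : Function.support (fun x => f x + c * g x) ⊆ Function.support f ∪ Function.support g := by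
    intro x hx
    by_contra h'
    simp only [Set.mem_union, Function.mem_support, not_or, not_not] at h'
    exact hx (by simp [h'.1, h'.2])
  simpa only [tsupport, closure_union] using closure_mono hs

/-- A smooth bump at `t` of radius `r`, supported in `[t-r, t+r]`, non-negative, equal to `1` at `t`. -/
private theorem exists_bump (t : ℝ) {r : ℝ} (hr : 0 < r) :
    ∃ g : ℝ → ℝ, ContDiff ℝ ∞ g ∧ HasCompactSupport g ∧ tsupport g = Icc (t - r) (t + r) ∧
      (∀ x, 0 ≤ g x) ∧ g t = 1 := by
  let b : ContDiffBump t := ⟨r / 2, r, by positivity, by linarith⟩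
  refine ⟨b, b.contDiff, b.hasCompactSupport, ?_, fun x => b.nonneg, ?_⟩
  · rw [b.tsupport_eq, Real.closedBall_eq_Icc]
  · exact b.one_of_mem_closedBall (mem_closedBall_self b.rIn_pos.le)

/-! ### Positivity and the spreading engine -/

/-- Positive semi-definiteness on smooth bumps and continuity force `φ ≥ 0` on `(0,∞)`. -/
private theorem phi_nonneg {φ : ℝ → ℝ} (hφ : ContinuousOn φ (Ioi 0))
    (hpsd : ∀ g : ℝ → ℝ, ContDiff ℝ ∞ g → HasCompactSupport g → tsupport g ⊆ Ioi 0 →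
      0 ≤ ∫ p : ℝ × ℝ, g p.1 * g p.2 * φ (p.1 + p.2))
    {u : ℝ} (hu : 0 < u) : 0 ≤ φ u := by
  by_contra hneg
  push Not at hneg
  -- `φ < 0` on a neighbourhood of `u`
  have hev : ∀ᶠ y in 𝓝 u, φ y < 0 := (hφ.continuousAt (Ioi_mem_nhds hu)).eventually (gt_mem_nhds hneg)
  obtain ⟨ε, hε, hεφ⟩ := Metric.eventually_nhds_iff.mp hev
  -- a bump at `u/2` of radius `r` with `2r < ε` and `r < u/2`
  set r : ℝ := min (ε / 4) (u / 4) with hr_def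
  have hr : 0 < r := by positivity
  have hrε : 4 * r ≤ ε := by
    have : r ≤ ε / 4 := min_le_left _ _
    linarith
  have hru : r < u / 2 := by
    have : r ≤ u / 4 := min_le_right _ _
    linarith
  obtain ⟨g, hgd, hgc, hgt, hgnn, hg1⟩ := exists_bump (u / 2) hr
  have hg0 : tsupport g ⊆ Ioi 0 := by
    rw [hgt]; intro x hx; simp only [mem_Icc] at hx; simp only [mem_Ioi]; linarith [hx.1]
  have h0 := hpsd g hgd hgc hg0
  -- the integrand is `≤ 0` everywhere and `< 0` at `(u/2, u/2)`
  have hF : Continuous fun p : ℝ × ℝ => g p.1 * g p.2 * φ (p.1 + p.2) :=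
    hankel_continuous hφ hgd.continuous hgd.continuous hg0 hg0
  have hFc : HasCompactSupport fun p : ℝ × ℝ => g p.1 * g p.2 * φ (p.1 + p.2) :=
    hankel_hasCompactSupport hgc hgc
  have hFnp : ∀ p : ℝ × ℝ, g p.1 * g p.2 * φ (p.1 + p.2) ≤ 0 := by
    intro p
    by_cases h1 : g p.1 = 0
    · simp [h1]
    by_cases h2 : g p.2 = 0
    · simp [h2]
    have hs : p.1 ∈ tsupport g := subset_tsupport _ (Function.mem_support.mpr h1)
    have ht : p.2 ∈ tsupport g := subset_tsupport _ (Function.mem_support.mpr h2)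
    rw [hgt, mem_Icc] at hs ht
    have hd : dist (p.1 + p.2) u < ε := by
      rw [Real.dist_eq, abs_lt]; constructor <;> linarith [hs.1, hs.2, ht.1, ht.2]
    have hφp : φ (p.1 + p.2) < 0 := hεφ hd
    have : 0 ≤ g p.1 * g p.2 := mul_nonneg (hgnn _) (hgnn _)
    nlinarith
  have hpos : 0 < ∫ p : ℝ × ℝ, -(g p.1 * g p.2 * φ (p.1 + p.2)) := by
    refine Continuous.integral_pos_of_hasCompactSupport_nonneg_nonzero hF.neg hFc.neg
      (fun p => by simpa using hFnp p) (x := (u / 2, u / 2)) ?_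
    have hφu : φ (u / 2 + u / 2) < 0 := by rw [add_halves]; exact hneg
    simp only [hg1, one_mul, neg_ne_zero]
    exact hφu.ne
  rw [integral_neg] at hpos
  linarith

/-- **The engine.**  If `f ≥ 0` is a `Q`-null test function and `Q` is positive semi-definite along `f + c·g` for
all smooth test `g`, then `φ` vanishes on `s + (0,∞)` for every `s` with `f s ≠ 0` (given `φ ≥ 0`). -/
private theorem engine {φ : ℝ → ℝ} (hφ : ContinuousOn φ (Ioi 0)) (hφnn : ∀ u, 0 < u → 0 ≤ φ u)
    {f : ℝ → ℝ} (hf : Continuous f) (hfc : HasCompactSupport f) (hf0 : tsupport f ⊆ Ioi 0)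
    (hfnn : ∀ x, 0 ≤ f x) (hnull : ∫ p : ℝ × ℝ, f p.1 * f p.2 * φ (p.1 + p.2) = 0)
    (hpsd : ∀ (c : ℝ) (g : ℝ → ℝ), ContDiff ℝ ∞ g → HasCompactSupport g → tsupport g ⊆ Ioi 0 →
      0 ≤ ∫ p : ℝ × ℝ, (f p.1 + c * g p.1) * (f p.2 + c * g p.2) * φ (p.1 + p.2))
    {s : ℝ} (hs : f s ≠ 0) {t : ℝ} (ht : 0 < t) : φ (s + t) = 0 := by
  obtain ⟨g, hgd, hgc, hgt, hgnn, hg1⟩ := exists_bump t (half_pos ht)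
  have hg0 : tsupport g ⊆ Ioi 0 := by
    rw [hgt]; intro x hx; simp only [mem_Icc] at hx; simp only [mem_Ioi]; linarith [hx.1]
  -- the cross term vanishes
  have hB : ∫ p : ℝ × ℝ, f p.1 * g p.2 * φ (p.1 + p.2) = 0 := by
    apply eq_zero_of_quadratic_nonneg (C := ∫ p : ℝ × ℝ, g p.1 * g p.2 * φ (p.1 + p.2))
    intro c
    have h := hpsd c g hgd hgc hg0
    rw [hankel_expand hφ hf hgd.continuous hfc hgc hf0 hg0, hnull, zero_add] at h
    exact h
  -- the integrand is continuous, non-negative, with zero integral: it vanishes identically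
  have hF : Continuous fun p : ℝ × ℝ => f p.1 * g p.2 * φ (p.1 + p.2) :=
    hankel_continuous hφ hf hgd.continuous hf0 hg0
  have hFnn : ∀ p : ℝ × ℝ, 0 ≤ f p.1 * g p.2 * φ (p.1 + p.2) := by
    intro p
    by_cases h1 : f p.1 = 0
    · simp [h1]
    by_cases h2 : g p.2 = 0
    · simp [h2]
    have h1' : p.1 ∈ tsupport f := subset_tsupport _ (Function.mem_support.mpr h1)
    have h2' : p.2 ∈ tsupport g := subset_tsupport _ (Function.mem_support.mpr h2)
    exact mul_nonneg (mul_nonneg (hfnn _) (hgnn _)) (hφnn _ (add_pos (hf0 h1') (hg0 h2')))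
  have hae : (fun p : ℝ × ℝ => f p.1 * g p.2 * φ (p.1 + p.2)) =ᵐ[volume] 0 :=
    (integral_eq_zero_iff_of_nonneg (fun p => hFnn p)
      (hankel_integrable hφ hf hgd.continuous hfc hgc hf0 hg0)).mp hB
  have hzero : (fun p : ℝ × ℝ => f p.1 * g p.2 * φ (p.1 + p.2)) = 0 :=
    (Continuous.ae_eq_iff_eq volume hF continuous_const).mp hae
  have hst := congr_fun hzero (s, t)
  simp only [hg1, mul_one, Pi.zero_apply, mul_eq_zero] at hst
  exact hst.resolve_left hs

/-! ### The theorem -/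

/-- **Null-vector rigidity of exponentially convex kernels (elementary heart of `Stmt_semigroupKill`).**
Let `φ` be continuous on `(0,∞)`; let `h ≥ 0` be continuous, compactly supported in `(0,∞)` and not identically
zero; suppose the Hankel form `Q(f) = ∫∫ f(s) f(t) φ(s+t)` is non-negative on every `c·h + g` with `g` smooth and
compactly supported in `(0,∞)`, and `Q(h) = 0`.  Then `φ = 0` on `(0,∞)`. -/
theorem expConvexKernel_eq_zero_of_null (φ : ℝ → ℝ) (hφ : ContinuousOn φ (Ioi 0))
    (h : ℝ → ℝ) (hh : Continuous h) (hhc : HasCompactSupport h) (hh0 : tsupport h ⊆ Ioi 0)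
    (hhnn : ∀ x, 0 ≤ h x) (hhne : ∃ x, h x ≠ 0)
    (hpsd : ∀ (c : ℝ) (g : ℝ → ℝ), ContDiff ℝ ∞ g → HasCompactSupport g → tsupport g ⊆ Ioi 0 →
      0 ≤ ∫ p : ℝ × ℝ, (c * h p.1 + g p.1) * (c * h p.2 + g p.2) * φ (p.1 + p.2))
    (hnull : ∫ p : ℝ × ℝ, h p.1 * h p.2 * φ (p.1 + p.2) = 0) :
    ∀ u, 0 < u → φ u = 0 := by
  -- `φ ≥ 0`
  have hφnn : ∀ u, 0 < u → 0 ≤ φ u := by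
    intro u hu
    refine phi_nonneg hφ (fun g hgd hgc hg0 => ?_) hu
    simpa using hpsd 0 g hgd hgc hg0
  -- PSD along `f + c g` for `f = h` and for any smooth test `f = m`
  have hpsd_h : ∀ (c : ℝ) (g : ℝ → ℝ), ContDiff ℝ ∞ g → HasCompactSupport g → tsupport g ⊆ Ioi 0 →
      0 ≤ ∫ p : ℝ × ℝ, (h p.1 + c * g p.1) * (h p.2 + c * g p.2) * φ (p.1 + p.2) := by
    intro c g hgd hgc hg0
    have := hpsd 1 (fun x => c * g x) (contDiff_const.mul hgd) (hgc.mul_left)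
      (tsupport_mul_subset_right.trans hg0)
    simpa only [one_mul] using this
  have hpsd_m : ∀ m : ℝ → ℝ, ContDiff ℝ ∞ m → HasCompactSupport m → tsupport m ⊆ Ioi 0 →
      ∀ (c : ℝ) (g : ℝ → ℝ), ContDiff ℝ ∞ g → HasCompactSupport g → tsupport g ⊆ Ioi 0 →
      0 ≤ ∫ p : ℝ × ℝ, (m p.1 + c * g p.1) * (m p.2 + c * g p.2) * φ (p.1 + p.2) := by
    intro m hmd hmc hm0 c g hgd hgc hg0
    have := hpsd 0 (fun x => m x + c * g x) (hmd.add (contDiff_const.mul hgd))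
      (hmc.add hgc.mul_left)
      ((tsupport_add_mul_subset c).trans (union_subset hm0 hg0))
    simpa only [zero_mul, zero_add] using this
  -- STEP 1: `φ = 0` above `s₀`, where `h s₀ ≠ 0`
  obtain ⟨s₀, hs₀⟩ := hhne
  have hs₀pos : 0 < s₀ := hh0 (subset_tsupport _ (Function.mem_support.mpr hs₀))
  have hZ0 : ∀ u, s₀ < u → φ u = 0 := by
    intro u hu
    have := engine hφ hφnn hh hhc hh0 hhnn hnull hpsd_h hs₀ (sub_pos.mpr hu)
    simpa using this
  -- STEP 2: halving the threshold
  have hZ : ∀ k : ℕ, ∀ u, s₀ / 2 ^ k < u → φ u = 0 := by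
    intro k
    induction k with
    | zero => intro u hu; exact hZ0 u (by simpa using hu)
    | succ k ih =>
      intro u hu
      set σ : ℝ := s₀ / 2 ^ k with hσ_def
      have hσ : 0 < σ := by positivity
      have huσ : σ / 2 < u := by
        rw [hσ_def, pow_succ] at *
        rw [div_div] ; exact hu
      by_cases hu' : σ < u
      · exact ih u hu'
      push Not at hu'
      -- the null bump `m` centred at `c₀ ∈ (σ/2, u)` with radius `r`, `c₀ - r > σ/2`
      set c₀ : ℝ := (σ / 2 + u) / 2 with hc₀_def
      set r : ℝ := (u - σ / 2) / 4 with hr_def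
      have hr : 0 < r := by rw [hr_def]; linarith
      have hc₀u : c₀ < u := by rw [hc₀_def]; linarith
      have hcr : σ / 2 < c₀ - r := by rw [hc₀_def, hr_def]; linarith
      have hc₀ : 0 < c₀ := by linarith
      have hrc : r < c₀ := by linarith
      obtain ⟨m, hmd, hmc, hmt, hmnn, hm1⟩ := exists_bump c₀ hr
      have hm0 : tsupport m ⊆ Ioi 0 := by
        rw [hmt]; intro x hx; simp only [mem_Icc] at hx; simp only [mem_Ioi]; linarith [hx.1]
      -- `m` is `Q`-null because `φ = 0` on `(σ, ∞) ⊇ supp m + supp m`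
      have hmnull : ∫ p : ℝ × ℝ, m p.1 * m p.2 * φ (p.1 + p.2) = 0 := by
        have : (fun p : ℝ × ℝ => m p.1 * m p.2 * φ (p.1 + p.2)) = fun _ => 0 := by
          funext p
          by_cases h1 : m p.1 = 0
          · simp [h1]
          by_cases h2 : m p.2 = 0
          · simp [h2]
          have h1' : p.1 ∈ tsupport m := subset_tsupport _ (Function.mem_support.mpr h1)
          have h2' : p.2 ∈ tsupport m := subset_tsupport _ (Function.mem_support.mpr h2)
          rw [hmt, mem_Icc] at h1' h2'
          have : σ < p.1 + p.2 := by linarith [h1'.1, h2'.1]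
          simp [ih _ this]
        rw [this, integral_const, smul_zero]
      have hφu := engine hφ hφnn hmd.continuous hmc hm0 hmnn hmnull (hpsd_m m hmd hmc hm0)
        (s := c₀) (by rw [hm1]; exact one_ne_zero) (t := u - c₀) (sub_pos.mpr hc₀u)
      simpa using hφu
  -- STEP 3: Archimedes
  intro u hu
  obtain ⟨k, hk⟩ := exists_pow_lt_of_lt_one (div_pos hu hs₀pos) (by norm_num : (1 / 2 : ℝ) < 1)
  refine hZ k u ?_
  rw [div_lt_iff₀ (by positivity)]
  have : (1 / 2 : ℝ) ^ k * s₀ < u := by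
    have := mul_lt_mul_of_pos_right hk hs₀pos
    rwa [div_mul_cancel₀ _ hs₀pos.ne'] at this
  calc s₀ = (1 / 2 : ℝ) ^ k * s₀ * 2 ^ k := by
        rw [one_div, inv_pow, mul_comm ((2 ^ k : ℝ)⁻¹), mul_assoc, inv_mul_cancel₀ (by positivity), mul_one]
    _ < u * 2 ^ k := by gcongr

end Summit.QuantumFields.YangMills.Cruxes.DetectorRigidity

end
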